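import Mathlib.LinearAlgebra.FiniteDimensional.Lemmas
import Mathlib.LinearAlgebra.Dimension.StrongRankCondition
import Mathlib.Algebra.BigOperators.Group.Finset.Basic
import Mathlib.Algebra.Module.BigOperators
import Mathlib.Algebra.Group.Invertible.Basic
import Mathlib.Tactic.NoncommRing
import Mathlib.Tactic.Linarith
import Summits.HodgeConjecture.HodgeConjecture.Theorems.WeilTypeLadderH2CurveClause
import HarnessLib

/-!
# The (0,1) cell of the ι-window, XI: the `G`-equivariant semiregularity theorem WITH FIXED POINTS (strong form) — algebraic skeleton

Family `hodge`, b2b cell `hweil` (helper of item stmt-HodgeConjecture-2524). Report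
`run/shared/lean/b2b/hodge-weil/b2b-hweil-pv1-g23/H2-ZERO-ONE-11.md` (prover 1 gen 23). Companion to `WeilTypeLadderH2CurveClause.lean` (gen 22),
whose section `SR833rank` (the (0,1) rank count) is imported. HONEST FRAMING: structure results about the ladder's H2 test ((0,1) cell) and about the
ladder's schematic input D25; no case of the Hodge conjecture is proved; nothing here is a rung; no statement of [Markman 2025] or [Perry 2026] is used
as a fact. The kernel content is the (elementary) algebra of the report's THEOREM U; the geometry is refereed print quoted in the report
(Buchweitz–Flenner 2003 Props. 3.11, 3.14, 4.4, 5.9 and the proof of Thm. 5.1; Bandiera–Lepri–Manetti 2023 Cor. 6.4; Pridham 2024 Cors. 2.21, 2.23).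

## THEOREM U (report §1), in one paragraph

Let `π : X → S` be a deformation of a compact complex algebraic manifold `X₀` over a smooth germ, `G` a FINITE group of `S`-automorphisms of `X`
(fixed points allowed; the case in hand is `G = {1, ι}`, `ι = −1` on a family of ppav fourfolds, `2⁸` fixed points per fibre), and `(E₀, λ)` a
`G`-linearised coherent sheaf on `X₀` such that the part `σ_I` of the Buchweitz–Flenner semiregularity map is injective ON THE INVARIANTS
`Ext²(E₀,E₀)^G` (Perry's "G-semiregular", Def. 2.6; the tree's `Literature.…IsInvariantISemiregular`). If the partial Chern character
`(ch_p(E₀))_{p ∈ I}` extends to a horizontal section, then `E₀` lifts to every infinitesimal neighbourhood `S_n` as a `G`-linearised `S_n`-flat sheaf,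
hence (B–F's versality + Artin approximation paragraph verbatim) its classes stay algebraic near `0`. PROOF SKELETON: at the step `S_n ⊂ S_{n+1}`
(extension by the `ℂ`-vector space `N = 𝔪ⁿ⁺¹/𝔪ⁿ⁺²`) the obstruction `o = ⟨ξ, −At(E_n)⟩ ∈ Ext²(E₀,E₀) ⊗ N` (B–F Prop. 4.4) is `G`-INVARIANT by
transport of structure (B–F Props. 3.11, 3.14: Atiyah classes are natural under sheaf isomorphisms and under automorphisms of the space; `ξ` is
`G`-invariant because `G` acts on `X_{n+1}`), and `(σ_I ⊗ 1)(o) = ⟨ξ, ch'_I⟩ = 0` exactly when the classes lift horizontally (B–F Prop. 5.9, whose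
proof uses injectivity of `σ_{I,N}` only to conclude `o = 0`); an invariant vector killed by a map injective on invariants is zero
(`esr_invariant_obstruction_zero`); the set of lifts is then a torsor with an AFFINE `G`-action, which has a fixed point by averaging
(`esr_affine_fixed_point`, `esr_affine_involution_fixed`), and a `G`-fixed lift carries a linearisation after the cocycle correction `μ ↦ μ(1 − ν/2)`
(`esr_cocycle_correction`; in general `H²(G, End(E₀) ⊗ N) = 0`). On a FIXED `X` the same invariance argument with Bandiera–Lepri–Manetti 2023
Cor. 6.4 (σ annihilates ALL obstructions) gives: `Def^G(E₀)` is smooth of dimension `dim Ext¹(E₀,E₀)^G`. For a (0,1) object of the ladder's H2 cell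
the hypothesis holds with `I` = all degrees: `ob : HT²(X) → Ext²(F,F)^ι` has `rank(σ ∘ ob) = rank ⌟ch(F) = 12 = dim Ext²(F,F)^ι` (Prop D, C74 (ii),
THEOREM 833), so `σ` is injective on `Ext²(F,F)^ι` (`esr_strong_of_rank`); hence every (0,1) object moves in a smooth NON-ISOTRIVIAL one-parameter
`ι`-equivariant family on its own fourfold, and exists on the very general ppav fourfold as soon as it exists on one.
-/

-- mandated namespace `Summit.HodgeConjecture.HodgeConjecture.…` (Problem = Summit) trips `linter.dupNamespace`; the lakefile disables it
-- tree-wide (weak option), restated here so stand-alone elaboration is warning-free too.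
set_option linter.dupNamespace false

namespace Summit.HodgeConjecture.HodgeConjecture.WeilTypeLadder

section EquivariantSRLinear

open Module

variable {R : Type*} [CommRing R]
variable {V W : Type*} [AddCommGroup V] [Module R V] [AddCommGroup W] [Module R W]

/-- **THEOREM U, step 3 (an invariant obstruction killed by a map injective on invariants vanishes).** `V = Ext²(E₀,E₀) ⊗ N` with the
`G`-action `ρ`, `W = ∏_{p∈I} H^{p+1}(Ω^{p−1}) ⊗ N`, `σ = σ_I ⊗ 1`; the obstruction `o` is `ρ`-fixed (transport of structure) and `σ o = 0`
(the classes stay Hodge, B–F Prop. 5.9 / Pridham Cor. 2.23); `σ` injective on the fixed vectors (strong `G`-semiregularity) forces `o = 0`.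
[cite: BuchweitzFlenner2003, Prop. 5.9; Perry2026Semiregularity, Def. 2.6] -/
theorem esr_invariant_obstruction_zero {ι : Type*} (ρ : ι → (V →ₗ[R] V)) (σ : V →ₗ[R] W)
    (hinj : ∀ v : V, (∀ g, ρ g v = v) → σ v = 0 → v = 0)
    {o : V} (hfix : ∀ g, ρ g o = o) (hσ : σ o = 0) : o = 0 :=
  hinj o hfix hσ

/-- **THEOREM U, step 3 with the coefficient module made explicit.** For `N ≅ ℂ^r` (`N = 𝔪ⁿ⁺¹/𝔪ⁿ⁺²` is a vector space),
`Ext²_{X_n}(E_n, E_n ⊗ N) ≅ Ext²(E₀,E₀)^{⊕ r}` with `G` acting diagonally and `σ_{I,N} = σ_I^{⊕ r}` (B–F Lemma 5.10, initial step); an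
`r`-tuple of invariant classes killed componentwise by `σ_I` is zero. [cite: BuchweitzFlenner2003, Lemma 5.10] -/
theorem esr_invariant_obstruction_zero_pi {ι : Type*} {r : ℕ} (ρ : ι → (V →ₗ[R] V)) (σ : V →ₗ[R] W)
    (hinj : ∀ v : V, (∀ g, ρ g v = v) → σ v = 0 → v = 0)
    {o : Fin r → V} (hfix : ∀ i g, ρ g (o i) = o i) (hσ : ∀ i, σ (o i) = 0) : o = 0 :=
  funext fun i => hinj (o i) (hfix i) (hσ i)

/-- **THEOREM U, step 4 (a torsor with an affine action of a finite group has a fixed point, by averaging).** The lifts of `E_n` to `X_{n+1}`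
form a torsor under `M = Ext¹(E₀,E₀) ⊗ N`; after choosing a base point, `g ∈ G` acts by `x ↦ ρ g x + b g` with the cocycle rule
`b (g * h) = ρ g (b h) + b g`. If `|G|` is invertible in the coefficients, `x₀ = ⅟|G| • Σ_h b h` is fixed by every `g`. [folklore] -/
theorem esr_affine_fixed_point {G : Type*} [Group G] [Fintype G] {M : Type*} [AddCommGroup M] [Module R M]
    (ρ : G → (M →ₗ[R] M)) (b : G → M) (hcocycle : ∀ g h : G, b (g * h) = ρ g (b h) + b g)
    (c : R) (hc : c * (Fintype.card G : R) = 1) :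
    ∀ g : G, ρ g (c • ∑ h : G, b h) + b g = c • ∑ h : G, b h := by
  intro g
  have hsum : ∑ h : G, b (g * h) = ∑ h : G, b h :=
    Fintype.sum_bijective (fun h => g * h) (Group.mulLeft_bijective g) (fun h => b (g * h)) (fun h => b h)
      (fun _ => rfl)
  have hexp : ∑ h : G, b (g * h) = ρ g (∑ h : G, b h) + (Fintype.card G : R) • b g := by
    simp_rw [hcocycle]
    rw [Finset.sum_add_distrib, ← map_sum, Finset.sum_const, Finset.card_univ, Nat.cast_smul_eq_nsmul]
  have key : ∑ h : G, b h = ρ g (∑ h : G, b h) + (Fintype.card G : R) • b g := hsum.symm.trans hexp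
  calc ρ g (c • ∑ h : G, b h) + b g = c • ρ g (∑ h : G, b h) + b g := by rw [LinearMap.map_smul]
    _ = c • (ρ g (∑ h : G, b h) + (Fintype.card G : R) • b g) := by
        rw [smul_add, smul_smul, hc, one_smul]
    _ = c • ∑ h : G, b h := by rw [← key]

/-- **THEOREM U, step 4 for an involution (the case `G = {1, ι}`).** An affine involution `x ↦ g x + b` of a module (`g ∘ g = id` forces
`g b + b = 0`) over coefficients in which `2` is invertible fixes `⅟2 • b`. [folklore] -/
theorem esr_affine_involution_fixed {M : Type*} [AddCommGroup M] [Module R M] [Invertible (2 : R)]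
    (g : M →ₗ[R] M) (b : M) (hb : g b + b = 0) : g (⅟(2 : R) • b) + b = ⅟(2 : R) • b := by
  have hgb : g b = -b := eq_neg_of_add_eq_zero_left hb
  rw [LinearMap.map_smul, hgb, smul_neg]
  have h2 : (⅟(2 : R)) • b + (⅟(2 : R)) • b = b := by
    rw [← add_smul, invOf_two_add_invOf_two, one_smul]
  -- -(½b) + b = ½b  ⟸  b = ½b + ½b
  nth_rewrite 2 [← h2]
  abel

/-- **THEOREM U, step 4, the cocycle correction.** A `G`-fixed lift `E'` carries isomorphisms `μ : E' ≅ ι^*E'` lifting the linearisation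
`λ_n`, with `ι^*μ ∘ μ = 1 + ν`, `ν ≡ 0 (mod N)`, so `ν² = 0`; `μν = (ι^*ν)μ`; replacing `μ` by `μ' = μ(1 − ν/2)` gives
`ι^*μ' ∘ μ' = (1 + ν)(1 − ν/2)² = 1`: a genuine linearisation. The ring identity: [folklore] -/
theorem esr_cocycle_correction {A : Type*} [Ring A] [Invertible (2 : A)] (ν : A) (hν : ν * ν = 0) :
    (1 + ν) * ((1 - ⅟(2 : A) * ν) * (1 - ⅟(2 : A) * ν)) = 1 := by
  have h2 : (⅟(2 : A)) * ν + (⅟(2 : A)) * ν = ν := by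
    rw [← add_mul, invOf_two_add_invOf_two, one_mul]
  have hcomm : Commute ν (2 : A) := by
    show ν * 2 = 2 * ν
    rw [mul_two, two_mul]
  have hc : ν * ⅟(2 : A) = ⅟(2 : A) * ν := (hcomm.invOf_right).eq
  have hνν : ⅟(2 : A) * ν * (⅟(2 : A) * ν) = 0 := by
    calc ⅟(2 : A) * ν * (⅟(2 : A) * ν) = ⅟(2 : A) * (ν * ⅟(2 : A)) * ν := by simp only [mul_assoc]
      _ = ⅟(2 : A) * (⅟(2 : A) * ν) * ν := by rw [hc]
      _ = ⅟(2 : A) * ⅟(2 : A) * (ν * ν) := by simp only [mul_assoc]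
      _ = 0 := by rw [hν, mul_zero]
  have hsq : (1 - ⅟(2 : A) * ν) * (1 - ⅟(2 : A) * ν) = 1 - ν := by
    calc (1 - ⅟(2 : A) * ν) * (1 - ⅟(2 : A) * ν)
        = 1 - (⅟(2 : A) * ν + ⅟(2 : A) * ν) + ⅟(2 : A) * ν * (⅟(2 : A) * ν) := by noncomm_ring
      _ = 1 - ν := by rw [h2, hνν, add_zero]
  rw [hsq]
  calc (1 + ν) * (1 - ν) = 1 - ν * ν := by noncomm_ring
    _ = 1 := by rw [hν, sub_zero]

end EquivariantSRLinear

section EquivariantSRRank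

open Module

variable {K : Type*} [DivisionRing K]
variable {H E Ω : Type*} [AddCommGroup H] [Module K H] [AddCommGroup E] [Module K E]
  [AddCommGroup Ω] [Module K Ω]

/-- **A (0,1) object is STRONGLY `ι`-semiregular.** Let `ev : H → E` model `ob_F : HT²(X) → Ext²(F,F)^ι` and `σ : E → Ω` the semiregularity
map on the invariants; for a (0,1) object `dim E = 12 ≤ rank(σ ∘ ev)` (`σ ∘ ev = ⌟ch(F)` has rank `28 − 16 = 12`, THEOREM 833 + Prop D, and
`e₂^ι = 12` on the design hyperplane, C74 (ii)). Then `σ` is injective on ALL of `E`: Perry's "G-semiregular" (Def. 2.6) for `G = {1, ι}`,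
the tree's `IsInvariantISemiregular` with `I = univ`. Proved from `sr833_ker_eq_of_finrank` (`ev` onto, `ker ev = ker(σ∘ev)`).
[cite: Perry2026Semiregularity, Def. 2.6] -/
theorem esr_strong_of_rank [FiniteDimensional K E] (ev : H →ₗ[K] E) (σ : E →ₗ[K] Ω)
    (h : finrank K E ≤ finrank K (LinearMap.range (σ ∘ₗ ev))) : ∀ x : E, σ x = 0 → x = 0 := by
  obtain ⟨hsurj, hker⟩ := sr833_ker_eq_of_finrank ev σ h
  intro x hx
  obtain ⟨y, rfl⟩ := hsurj x
  have hy : y ∈ LinearMap.ker (σ ∘ₗ ev) := by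
    rw [LinearMap.mem_ker, LinearMap.comp_apply]; exact hx
  rw [← hker, LinearMap.mem_ker] at hy
  exact hy

/-- **COROLLARY U1's dimension (the (0,1) locus is a smooth CURVE).** Unobstructedness makes the local dimension of the `ι`-equivariant
deformation space equal to its tangent dimension `e₁^ι`; on the design hyperplane `χ + χ_ι + 4e₁^ι = 28` with `χ = 24`, `χ_ι = 0` this is `1`.
[cite: BandieraLepriManetti2023, Cor. 6.4] -/
theorem esr_deformation_dim_one (χ χι e1 d : ℤ) (hplane : χ + χι + 4 * e1 = 28) (hχ : χ = 24) (hχι : χι = 0)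
    (hsmooth : d = e1) : d = 1 := by
  subst hsmooth; omega

end EquivariantSRRank

section EquivariantSRRows

/-- **REMARK 3.3′ (row (4.3) of the census: push-forwards from the (1,1,1,2) double cover).** If `F = ρ_*G̃` is a (0,1) object then by
adjunction `Ext¹(F,F)^ι = Ext¹(G̃,G̃)^{ι′} ⊕ Ext¹(τ^*G̃,G̃)^ι`, so `1 = e₁^ι(F) = e₁^{ι′}(G̃) + d` with `d ≥ 0`; with the design equation on the cover
`χ_{ι′} + 4e₁^{ι′} = 16` and `χ_{ι′} ∈ {0, 8, 12, 14, 16}` (Proposition Λ₈ on `X′`, even rank) only `(χ_{ι′}, e₁^{ι′}) ∈ {(16,0), (12,1)}` survive: the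
pairs `(8,2)` and `(0,4)` of H2-CENSUS (4.3) are void for push-forwards. Report §3.3. [new] -/
theorem esr_pushforward_window (χι' e1' d : ℤ) (hsum : e1' + d = 1) (hd : 0 ≤ d) (he : 0 ≤ e1')
    (hdesign : χι' + 4 * e1' = 16) :
    (χι' = 16 ∧ e1' = 0 ∧ d = 1) ∨ (χι' = 12 ∧ e1' = 1 ∧ d = 0) := by
  omega

/-- **§3.4 (i): the H2 class on a product `B₁ × B₂` of principally polarised abelian surfaces is twice an ideal-sheaf class.** With
`θ = θ₁ + θ₂`, `θᵢ² = 2pᵢ`, `θᵢ³ = 0`: `θ² = 2(p₁ + θ₁θ₂ + p₂) = 2[S₀]` and `θ³ = 6(p₁θ₂ + θ₁p₂) = 6[Γ₀]` for `S₀ = {p}×B₂ ∪ C₁×C₂ ∪ B₁×{p′}`,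
`Γ₀ = {p}×C₂ ∪ C₁×{p′}`; GRR gives `ch(𝓘_{S₀}) = 1 − [S₀] + [Γ₀] − χ(𝒪_{S₀})·[pt]` with `χ(𝒪_{S₀}) = 0 + 1 + 0 − 1 = 0` (two abelian surfaces, one
product of genus-2 curves, one transversal intersection point), so `v = 2 − θ² + θ³/3 = 2·ch(𝓘_{S₀})`. The coefficient bookkeeping in the basis
`(1, [S₀], [Γ₀], [pt])`: [new] -/
theorem esr_product_dictionary (χB χC χpt : ℤ) (hB : χB = 0) (hC : χC = 1) (hpt : χpt = 1)
    (v0 v2 v3 v4 w0 w2 w3 w4 : ℤ)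
    (hv : v0 = 2 ∧ v2 = -2 ∧ v3 = 2 ∧ v4 = 0)                      -- v = 2 − θ² + θ³/3: coefficients of 1, [S₀] (= θ²/2), [Γ₀] (= θ³/6), [pt]
    (hw : w0 = 1 ∧ w2 = -1 ∧ w3 = 1 ∧ w4 = -(χB + χC + χB - χpt)) : -- ch(𝓘_{S₀}) = 1 − [S₀] + [Γ₀] − χ(𝒪_{S₀})[pt]
    v0 = 2 * w0 ∧ v2 = 2 * w2 ∧ v3 = 2 * w3 ∧ v4 = 2 * w4 := by
  omega

end EquivariantSRRows

section LeadA

/-- **KOSZUL PARITY LEMMA (report §8.2 (a)), complete-intersection surface germs at an isolated fixed point of `ι′` (dι′ = −1 on a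
fourfold).** The Koszul complex on `ι′`-eigen-generators `f₁, f₂` with signs `ε₁, ε₂ ∈ {±1}` is an equivariant free resolution, so the local index of
the structure sheaf is `t(𝒪_Z) = (1 − ε₁)(1 − ε₂)` and `t(𝓘_Z) = 1 − t(𝒪_Z)`: `(odd, odd)` (e.g. a smooth point: (T4)) gives `t(𝓘_Z) = −3`, while ONE EVEN
equation (two sheets crossing along a curve `(x₁, x₂x₃)`, a quadratic cone, four planes in a 4-cycle `(x₁x₃, x₂x₄)`) gives `t(𝒪_Z) = 0`, `t(𝓘_Z) = +1`:
supports may pass through 2-torsion points where the germ has an even equation. [new] -/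
theorem esr_koszul_parity_surface (ε₁ ε₂ : ℤ) (h₁ : ε₁ = 1 ∨ ε₁ = -1) (h₂ : ε₂ = 1 ∨ ε₂ = -1) :
    ((1 - ε₁) * (1 - ε₂) = 4 ↔ (ε₁ = -1 ∧ ε₂ = -1)) ∧
    ((1 - ε₁) * (1 - ε₂) = 0 ↔ (ε₁ = 1 ∨ ε₂ = 1)) ∧
    (1 - (1 - ε₁) * (1 - ε₂) = 1 ∨ 1 - (1 - ε₁) * (1 - ε₂) = -3) := by
  rcases h₁ with rfl | rfl <;> rcases h₂ with rfl | rfl <;> norm_num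

/-- **KOSZUL PARITY LEMMA, arrangement form (report §8.2 (b)).** For a germ which is a union of `E` coordinate planes using `V` of the four
(anti-invariant) coordinate directions, the Stanley–Reisner evaluation gives `t(𝒪_Z) = 16 − 8V + 4E`; a simple graph on `V ≤ 4` vertices without isolated
vertices has `V ≤ 2E` and `2E ≤ V(V−1)`. Then `t(𝓘_Z) = ±1`, i.e. `t(𝒪_Z) ∈ {0, 2}`, happens EXACTLY for `(V,E) ∈ {(0,0), (3,2), (4,4)}` — a path of two planes
sharing a line, or four planes (4-cycle / paw); one plane, two transversal planes, three planes, `E = 3` are forbidden at a fixed point. [new] -/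
theorem esr_koszul_parity_arrangement (V E : ℕ) (hV : V ≤ 4) (hVE : V ≤ 2 * E) (hEV : 2 * E ≤ V * (V - 1))
    (ht : (16 : ℤ) - 8 * V + 4 * E = 0 ∨ (16 : ℤ) - 8 * V + 4 * E = 2) :
    (V = 0 ∧ E = 0) ∨ (V = 3 ∧ E = 2) ∨ (V = 4 ∧ E = 4) := by
  interval_cases V <;> omega

/-- **SUB-CENSUS A-2 (α) (report §8.4): 2-torsion coordinate arrangements on `Ẽ₁ × E₂ × E₃ × E₄` are VOID.** With all components 2-torsion translates
every special point is a 2-torsion point, where only `(3,2)`-points (contributing `1 − V + E = 0` to `χ(𝒪_Z̃)`) and `(4,4)`-points (contributing `+1`) are allowed;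
the complementary pair (directions `{1,2}` and `{3,4}`, both forced by the class `θ̃²/2`) meets at a 2-torsion point which must therefore be a `(4,4)`-point, so
`n₄₄ ≥ 1` and `χ(𝒪_{Z̃}) = n₄₄ ≠ 0`, contradicting (Z1). Incidence count for the record: nine components with sixteen fixed points each, `144 = 2n₃₂ + 4n₄₄`.
[new] -/
theorem esr_arrangement_two_torsion_void (n32 n44 χ : ℤ) (hinc : 2 * n32 + 4 * n44 = 144) (hχ : χ = n44)
    (hforced : 1 ≤ n44) : χ ≠ 0 ∧ n32 + 2 * n44 = 72 := by
  constructor <;> omega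

/-- **SUB-CENSUS A-1 (report §8.3): a SMOOTH irreducible half-class surface `Z̃ ⊂ X̃` is impossible.** `[Z̃]² = θ̃⁴/4 = 12 = c₂(N)`, `c₁(N) = K` give
`e(Z̃) = K² − 12`; Noether with `χ(𝒪_{Z̃}) = 0` gives `K² + e = 0`; so `K² = 6`, `e = −6 < 0`; a surface with negative Euler number is ruled over a curve of
genus `g` with `χ(𝒪) = 1 − g` and `e = 4(1 − g) + b`, `b ≥ 0` blow-ups — but `χ = 0` forces `g = 1` and `e = b ≥ 0`. [new] -/
theorem esr_smooth_halfclass_void (K2 e g b : ℤ) (hsplit : e = K2 - 12) (hnoether : K2 + e = 0)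
    (hruled : e = 4 * (1 - g) + b) (hb : 0 ≤ b) (hchi : 1 - g = 0) : False := by
  omega

/-- **Markman's recipe one genus down (report §8.1, why half-class surfaces):** on a ppav threefold the ideal of `n` disjoint translates of the Abel–Jacobi curve has
`ch = (1, 0, −n, 2n)` in the basis `θ^k/k!`, and `(1, 0, −n, 2n) = 2Re(a·(1, λ, λ², λ³))` forces `Re a = 1/2`, `|λ|² = n`, `Re λ = −1`, i.e. `λ = −1 ± √(1−n)`:
the field is `ℚ(√(1−n))` (`n = 4` ↔ `ℚ(√−3)`). The real-part bookkeeping with `λ = p + qi`, `a = 1/2 + iy`: [folklore] -/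
theorem esr_markman_threefold_secant (p q y n : ℚ) (h1 : p - 2 * y * q = 0)
    (h2 : (p ^ 2 - q ^ 2) - 2 * y * (2 * p * q) = -n) (h3 : (p ^ 3 - 3 * p * q ^ 2) - 2 * y * (3 * p ^ 2 * q - q ^ 3) = 2 * n) :
    p ^ 2 + q ^ 2 = n ∧ (n ≠ 0 → p = -1) := by
  have hy : 2 * y * q = p := by linarith
  have e2 : 2 * y * (2 * p * q) = 2 * p * p := by
    rw [show 2 * y * (2 * p * q) = 2 * p * (2 * y * q) by ring, hy]
  have e3 : 2 * y * (3 * p ^ 2 * q - q ^ 3) = p * (3 * p ^ 2 - q ^ 2) := by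
    rw [show 2 * y * (3 * p ^ 2 * q - q ^ 3) = (2 * y * q) * (3 * p ^ 2 - q ^ 2) by ring, hy]
  have hn : p ^ 2 + q ^ 2 = n := by
    rw [e2] at h2
    nlinarith [h2]
  refine ⟨hn, fun hn0 => ?_⟩
  have h3' : -2 * p * (p ^ 2 + q ^ 2) = 2 * n := by
    rw [e3] at h3
    linarith [h3, show p * (3 * p ^ 2 - q ^ 2) = 3 * p ^ 3 - p * q ^ 2 by ring,
      show -2 * p * (p ^ 2 + q ^ 2) = -2 * p ^ 3 - 2 * (p * q ^ 2) by ring,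
      show (3 : ℚ) * p * q ^ 2 = 3 * (p * q ^ 2) by ring]
  rw [hn] at h3'
  have : (p + 1) * n = 0 := by
    linarith [h3', show (p + 1) * n = p * n + n by ring, show -2 * p * n = -2 * (p * n) by ring]
  rcases mul_eq_zero.mp this with h | h
  · linarith
  · exact absurd h hn0

end LeadA

section DictionaryConfig

/-- **§3.4 (i) / `esr_product_dictionary`, configuration hypotheses made explicit — answer to W-P1g23-dict (referee-g89 R520, referee-g91 R534;
report §9.2).** On `X = B₁ × B₂` take `S₀ = {p} × B₂ ∪ C₁ × C₂ ∪ B₁ × {p′}` with the symmetric theta curves `Cᵢ = Θ_{κᵢ}` and 2-torsion points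
**`p ∈ B₁[2] ∖ C₁`, `p′ ∈ B₂[2] ∖ C₂`** (each `Cᵢ` contains 6 of the 16 two-torsion points, so 10 choices each). Then the pairwise intersections of the
three components are: `{p} × B₂ ∩ C₁ × C₂ = ({p} ∩ C₁) × C₂ = ∅` (since `p ∉ C₁` — it is NOT the curve `{p} × C₂`), `B₁ × {p′} ∩ C₁ × C₂ = ∅` (since
`p′ ∉ C₂`), and `{p} × B₂ ∩ B₁ × {p′} = {(p,p′)}`, one transversal point; no triple intersection. So `S₀` is the DISJOINT union of `C₁ × C₂` and the
cross `{p} × B₂ ∪ B₁ × {p′}`, and by additivity plus Mayer–Vietoris for the cross,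
`χ(𝒪_{S₀}) = χ(𝒪_{C₁×C₂}) + χ(𝒪_{p×B₂}) + χ(𝒪_{B₁×p′}) − χ(𝒪_{(p,p′)}) = 1 + 0 + 0 − 1 = 0`; with GRR for `C₁ × C₂` (normal bundle `K_{C₁} ⊞ K_{C₂}`,
`∫c₁² = 8`, `∫c₂ = 4`: `ch(𝒪_{C₁×C₂}) = θ₁θ₂ − (p₁θ₂ + θ₁p₂) + [pt]`) and `ch(𝒪_{abelian surface}) = its class`, one gets `ch(𝒪_{S₀}) = [S₀] − θ³/6`, i.e.
`ch(𝓘_{S₀}) = 1 − θ²/2 + θ³/6 = w` and `v = 2·ch(𝓘_{S₀})` in all degrees. The curve `Γ₀ = {p} × C₂ ∪ C₁ × {p′}` named in `esr_product_dictionary` is a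
REPRESENTATIVE of the class `θ³/6`, not an intersection of components. The integer bookkeeping with the three pairwise intersections explicit: [new] -/
theorem esr_product_dictionary_config (χCC χpB χBp χpt : ℤ) (hCC : χCC = 1) (hpB : χpB = 0) (hBp : χBp = 0) (hpt : χpt = 1)
    (i₁₂ i₁₃ i₂₃ : ℤ)
    (h₁₂ : i₁₂ = 0)      -- χ(𝒪_{p×B₂ ∩ C₁×C₂}) : empty, p ∉ C₁
    (h₂₃ : i₂₃ = 0)      -- χ(𝒪_{C₁×C₂ ∩ B₁×p′}) : empty, p′ ∉ C₂
    (h₁₃ : i₁₃ = χpt)    -- χ(𝒪_{p×B₂ ∩ B₁×p′}) : the transversal point (p,p′)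
    (χS₀ : ℤ) (hS : χS₀ = χpB + χCC + χBp - i₁₂ - i₁₃ - i₂₃) :
    χS₀ = 0 ∧ χS₀ = χpB + χCC + χBp - χpt := by
  constructor <;> omega

end DictionaryConfig

section KoszulArrangementConfig

/-- **KOSZUL PARITY LEMMA, arrangement form — wording of `esr_koszul_parity_arrangement` made exact (W-P1g23-koszul-a, referee-g93 R548;
report `b2b-hweil-pv1-g24/H2-ZERO-ONE-12.md` §6.1).** In `esr_koszul_parity_arrangement` the disjunct `(V,E) = (0,0)` is VACUOUS under its
hypothesis `ht`: the Stanley–Reisner ring of the empty complex on zero vertices is the reduced POINT, whose index is `16 − 0 + 0 = 16 ∉ {0, 2}`.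
The reading 'no plane of `Z` passes through the fixed point `x`' means `x ∉ Z` and `t_x(𝒪_Z) = 0` trivially — it is OUTSIDE the formula, which
concerns points `x ∈ Z` (`E ≥ 1`, hence `V ≥ 2`). Moreover `16 − 8V + 4E ≡ 0 (mod 4)`, so the value `2` NEVER occurs: at a fixed point lying on an
arrangement germ, `t_x(𝓘_Z) = ±1` forces `t_x(𝒪_Z) = 0` exactly, and under the graph constraints (`V ≤ 4` directions used, no isolated vertex:
`V ≤ 2E`, simple graph: `2E ≤ V(V−1)`) the solutions are EXACTLY `(V,E) ∈ {(3,2), (4,4)}` — two planes sharing a line, or four planes forming a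
4-cycle or a paw — both with `t_x(𝒪_Z) = 0`. No statement of report [11] §8 used the `(0,0)` clause (sub-census A-2 uses `(3,2) ↦ 0` and
`(4,4) ↦ +1` only). The general form (any `ι′`-stable germ of dimension `≤ 2`, not only arrangements): `t_x(𝒪_Z) ∈ 4ℤ`, report [12] §2. [new] -/
theorem esr_koszul_parity_arrangement_exact (V E : ℕ) (hE : 1 ≤ E) (hV : V ≤ 4) (hVE : V ≤ 2 * E)
    (hEV : 2 * E ≤ V * (V - 1)) :
    (4 : ℤ) ∣ (16 : ℤ) - 8 * V + 4 * E ∧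
    (16 : ℤ) - 8 * V + 4 * E ≠ 2 ∧
    ((16 : ℤ) - 8 * V + 4 * E = 0 ↔ (V = 3 ∧ E = 2) ∨ (V = 4 ∧ E = 4)) := by
  refine ⟨⟨4 - 2 * (V : ℤ) + E, by ring⟩, by omega, ?_⟩
  interval_cases V <;> omega

end KoszulArrangementConfig

end Summit.HodgeConjecture.HodgeConjecture.WeilTypeLadder
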